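import Summits.QuantumFields.YangMills.Theorems.ForcedResponseSkewnessRunningCouplingCeilingDefs
import Summits.QuantumFields.YangMills.Theorems.LangevinControlUVOSLegsFromFemtoAndGapStubAssemblyPlaneExpansion
import Summits.QuantumFields.YangMills.Theorems.BalabanLadderNTCumulantPolarisationDefs
import Summits.QuantumFields.YangMills.Theorems.LangevinControlUVOSLegsFromFemtoAndGapStubCollar
import HarnessLib

/-!
# Crux `RunningCouplingCeiling` (repaired: stmt-QuantumFields-24275), line `pointwise-log-ceiling`: the LOCAL scale-free
# kernel clause is the `n = 2` collar output (`MomentBounds`, hence the spine's UV leg `MomentBounds6`)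

Support file (`--supports stmt-QuantumFields-24275`) by the width prover `ym-line-frs-p3` of route `ForcedResponseSkewness`
(lead `ym-line-frs-p1`).  After `…RunningCouplingCeilingUniformSmearLocal` the physics half of the line owes, besides the
running-coupling log clause, only the LOCAL scale-free clause

  `n₀ ≤ d → a(β)·d ≤ ℓ → d⁸ |Cov_T(dens_x, dens_y)| ≤ C₁(ℓ)`   (`d` = torus distance, every odd torus, `β ≥ β₀`).

This file shows that this clause is exactly hyperscaling at fixed physical separation, i.e. the `n = 2` case of the collar
output `MomentBounds G r a` of `…LangevinControlUVOSLegsFromFemtoAndGapDefs` (and hence of the plane-resolved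
`MomentBounds6 G r a` — the UV leg of the spine `BalabanLadder` — by the tree's `momentBounds_of_momentBounds6`):

* `exists_sup_coord` — the torus distance is at most twice the largest cyclic coordinate separation, which is `≤ L`;
* `abs_torusCov_le_of_momentBounds_two` — `MomentBounds` at `n = 2`: `|torusCov β L x y| ≤ (C/R⁴)²` for collar radius `R`;
* `localScaleFree_of_momentBounds` — **`MomentBounds G r a →` for every `ℓ > 0` there are `C₁ n₀ β₀` with
  `d⁸|torusCov β L x y| ≤ C₁` whenever `n₀ ≤ d`, `a(β)·d ≤ ℓ`** (collar radius `R = min((m−8)/4, ⌊ℓ₄/a(β)⌋)`, `m` the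
  sup separation, `d ≤ 2m`; `C₁ = C²(16⁸ + (2ℓ/ℓ₄)⁸)`, `n₀ = 48`, `a(β) ≤ ℓ₄/2`);
* `localScaleFree_of_momentBounds6` — the same from `MomentBounds6`.

So the crux's NEW physics, beyond the UV leg the spine already carries, is only the running-coupling decay
`d⁸|Cov| ≤ C₀/log²(1/(a(β) d))` below the unit (and its unit-pinning by the floor).

Honest label: a reduction inside a CONDITIONAL rung line (leaf R2a `BalabanLadder.NT`); `MomentBounds`/`MomentBounds6` are
NOT proved here (they are the spine's UV inputs); nothing in this file bears on the Yang–Mills mass gap, which is NOT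
proved by any of this.
-/

set_option autoImplicit false

noncomputable section

namespace Summit.QuantumFields.YangMills.Cruxes.RunningCouplingCeiling.Pointwise

open MeasureTheory Filter Topology Finset
open Literature.MathematicalPhysics.QuantumFieldTheory Literature.MathematicalPhysics.QuantumLattice
open Literature.Probability.LatticeModels
open Summit.QuantumFields.YangMills.Cruxes.OSLegsFromFemtoAndGap.DlrCollarTransfer
open Summit.QuantumFields.YangMills.Theorems.OSLegsFromFemtoAndGap (momentBounds_of_momentBounds6)
open Summit.QuantumFields.YangMills.Cruxes.NT.CumulantPolarisation (torusE_centred_centred)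

/-! ### Torus distance versus the largest cyclic coordinate separation -/

/-- **Sup coordinate of the torus distance.**  For sites `x, y` and the cyclic separations
`v_k = valMinAbs (x_k − y_k) ∈ ℤ/(2L+1)`, some coordinate `k` has `|v_j| ≤ |v_k|` for all `j`, `|v_k| ≤ L`, and
`torusDist L x y ≤ 2|v_k|`. [folklore] -/
theorem exists_sup_coord (L : ℕ) (x y : Fin 4 → ℤ) :
    ∃ k : Fin 4, (∀ j : Fin 4, ((x j - y j : ℤ) : ZMod (2 * L + 1)).valMinAbs.natAbs ≤
        ((x k - y k : ℤ) : ZMod (2 * L + 1)).valMinAbs.natAbs) ∧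
      ((x k - y k : ℤ) : ZMod (2 * L + 1)).valMinAbs.natAbs ≤ L ∧
      torusDist L x y ≤ 2 * (((x k - y k : ℤ) : ZMod (2 * L + 1)).valMinAbs.natAbs : ℝ) := by
  classical
  obtain ⟨k, -, hk⟩ := Finset.exists_max_image (Finset.univ : Finset (Fin 4))
    (fun j => ((x j - y j : ℤ) : ZMod (2 * L + 1)).valMinAbs.natAbs) Finset.univ_nonempty
  set m : ℕ := ((x k - y k : ℤ) : ZMod (2 * L + 1)).valMinAbs.natAbs with hm
  have hk' : ∀ j : Fin 4, ((x j - y j : ℤ) : ZMod (2 * L + 1)).valMinAbs.natAbs ≤ m := fun j => hk j (mem_univ j)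
  refine ⟨k, hk', ?_, ?_⟩
  · have h := ZMod.natAbs_valMinAbs_le (((x k - y k : ℤ) : ZMod (2 * L + 1)))
    omega
  · unfold torusDist
    have hsq : ∀ j : Fin 4, ((((x j - y j : ℤ) : ZMod (2 * L + 1)).valMinAbs : ℤ) : ℝ) ^ 2 ≤ (m : ℝ) ^ 2 := by
      intro j
      have h1 : |((((x j - y j : ℤ) : ZMod (2 * L + 1)).valMinAbs : ℤ) : ℝ)| ≤ (m : ℝ) := by
        rw [← Int.cast_abs, Int.abs_eq_natAbs]
        exact_mod_cast hk' j
      rw [← sq_abs]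
      exact pow_le_pow_left₀ (abs_nonneg _) h1 2
    have hsum : ∑ j : Fin 4, ((((x j - y j : ℤ) : ZMod (2 * L + 1)).valMinAbs : ℤ) : ℝ) ^ 2 ≤ (2 * (m : ℝ)) ^ 2 := by
      calc ∑ j : Fin 4, ((((x j - y j : ℤ) : ZMod (2 * L + 1)).valMinAbs : ℤ) : ℝ) ^ 2
          ≤ ∑ _j : Fin 4, (m : ℝ) ^ 2 := Finset.sum_le_sum fun j _ => hsq j
        _ = (2 * (m : ℝ)) ^ 2 := by simp; ring
    rw [Real.sqrt_le_iff]
    exact ⟨by positivity, hsum⟩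

/-! ### `MomentBounds` at `n = 2` -/

section Cov

variable {G : Type} [Group G] [TopologicalSpace G] [IsTopologicalGroup G] [CompactSpace G]
  [MeasurableSpace G] [BorelSpace G] (r : LatticeRep G)

/-- **The collar output at `n = 2`.**  Under the `n`-point bound of `MomentBounds` at coupling `β` (constant `C`,
radius `R`, torus `L`), two sites with a cyclic coordinate separation `≥ 2R+4` have `|torusCov β L x y| ≤ (C/R⁴)²`.
[folklore] -/
theorem abs_torusCov_le_of_momentBounds_two (β : ℝ) {C : ℝ} {L : ℕ} {R : ℕ}
    (H : ∀ (n : ℕ) (x : Fin n → (Fin 4 → ℤ)),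
      (∀ i j : Fin n, i ≠ j → ∃ k : Fin 4,
        (2 * (R : ℤ) + 4) ≤ |((((x i k - x j k : ℤ) : ZMod (2 * L + 1))).valMinAbs : ℤ)|) →
      |torusE G r β L (fun U => ∏ i, (dens G r (x i) U - torusE G r β L (dens G r (x i))))| ≤
        (C / (R : ℝ) ^ 4) ^ n)
    (x y : Fin 4 → ℤ)
    (hsep : ∃ k : Fin 4, (2 * (R : ℤ) + 4) ≤ |((((x k - y k : ℤ) : ZMod (2 * L + 1))).valMinAbs : ℤ)|) :
    |torusCov G r β L x y| ≤ (C / (R : ℝ) ^ 4) ^ 2 := by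
  have hsep' : ∀ i j : Fin 2, i ≠ j → ∃ k : Fin 4,
      (2 * (R : ℤ) + 4) ≤ |((((![x, y] i k - ![x, y] j k : ℤ) : ZMod (2 * L + 1))).valMinAbs : ℤ)| := by
    intro i j hij
    fin_cases i <;> fin_cases j
    · exact absurd rfl hij
    · simpa using hsep
    · obtain ⟨k, hk⟩ := hsep
      have h : ((y k - x k : ℤ) : ZMod (2 * L + 1)) = -((x k - y k : ℤ) : ZMod (2 * L + 1)) := by
        push_cast; ring
      refine ⟨k, ?_⟩
      have hk' : (2 * (R : ℤ) + 4) ≤ |((((y k - x k : ℤ) : ZMod (2 * L + 1))).valMinAbs : ℤ)| := by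
        rw [h, Int.abs_eq_natAbs, ZMod.natAbs_valMinAbs_neg, ← Int.abs_eq_natAbs]
        exact hk
      simpa using hk'
    · exact absurd rfl hij
  have h := H 2 ![x, y] hsep'
  have hprod : (fun U => ∏ i : Fin 2, (dens G r (![x, y] i) U - torusE G r β L (dens G r (![x, y] i)))) =
      fun U => (dens G r x U - torusE G r β L (dens G r x)) * (dens G r y U - torusE G r β L (dens G r y)) := by
    funext U
    rw [Fin.prod_univ_two]
    simp
  rw [hprod, torusE_centred_centred G r β L (continuous_dens r x) (continuous_dens r y)] at h
  unfold torusCov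
  have e : torusE G r β L (fun U => dens G r x U * dens G r y U) -
        torusE G r β L (dens G r y) * torusE G r β L (dens G r x) -
        torusE G r β L (dens G r x) * torusE G r β L (dens G r y) +
        torusE G r β L (dens G r x) * torusE G r β L (dens G r y) =
      torusE G r β L (fun U => dens G r x U * dens G r y U) -
        torusE G r β L (dens G r x) * torusE G r β L (dens G r y) := by ring
  rwa [e] at h

/-! ### The local scale-free clause from the collar output -/

/-- **The LOCAL scale-free kernel clause is the `n = 2` collar output.**  If `MomentBounds G r a` holds (`a > 0`,
`a → 0`), then for every physical radius `ℓ > 0` there are `C₁ n₀ β₀` such that for all `β ≥ β₀`, every odd torus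
`2L+1` and all sites `x, y` with torus distance `d ≥ n₀` and physical separation `a(β)·d ≤ ℓ`:
`d⁸ |torusCov β L x y| ≤ C₁` (`C₁ = C²(16⁸ + (2ℓ/ℓ₄)⁸)`, `n₀ = 48`, `a(β₀') ≤ ℓ₄/2`; collar radius
`R = min((m−8)/4, ⌊ℓ₄/a(β)⌋)` with `m ≤ L` the largest cyclic coordinate separation, `d ≤ 2m`). [folklore] -/
theorem localScaleFree_of_momentBounds {a : ℝ → ℝ} (ha : ∀ β, 0 < a β) (ha0 : Tendsto a atTop (𝓝 0))
    (h : MomentBounds G r a) (ℓ : ℝ) (hℓ : 0 < ℓ) :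
    ∃ C₁ : ℝ, ∃ n₀ : ℕ, ∃ β₀ : ℝ, ∀ β : ℝ, β₀ ≤ β → ∀ (L : ℕ) (x y : Fin 4 → ℤ),
      (n₀ : ℝ) ≤ torusDist L x y → a β * torusDist L x y ≤ ℓ →
        torusDist L x y ^ 8 * |torusCov G r β L x y| ≤ C₁ := by
  obtain ⟨C, β₄, ℓ₄, hℓ₄, hC, H⟩ := h
  obtain ⟨β₁, hβ₁⟩ := Filter.eventually_atTop.1 (ha0.eventually (Iic_mem_nhds (half_pos hℓ₄)))
  refine ⟨C ^ 2 * (16 ^ 8 + (2 * ℓ / ℓ₄) ^ 8), 48, max β₄ β₁, fun β hβ L x y hd hdℓ => ?_⟩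
  have haβ : a β ≤ ℓ₄ / 2 := hβ₁ β (le_trans (le_max_right _ _) hβ)
  have ha' : 0 < a β := ha β
  set d : ℝ := torusDist L x y with hd_def
  -- the sup coordinate
  obtain ⟨k, hk, hmL, hdm⟩ := exists_sup_coord L x y
  set m : ℕ := ((x k - y k : ℤ) : ZMod (2 * L + 1)).valMinAbs.natAbs with hm_def
  have hd48 : (48 : ℝ) ≤ d := by exact_mod_cast hd
  rw [← hd_def] at hdm
  have hm24 : 24 ≤ m := by
    have : (24 : ℝ) ≤ m := by linarith
    exact_mod_cast this
  -- the two candidate radii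
  set R₁ : ℕ := (m - 8) / 4 with hR₁_def
  have hR₁a : 1 ≤ R₁ := by omega
  have hR₁b : 4 * R₁ + 8 ≤ m := by omega
  have hR₁c : m ≤ 8 * R₁ := by omega
  set R₂ : ℕ := ⌊ℓ₄ / a β⌋₊ with hR₂_def
  have hq2 : (2 : ℝ) ≤ ℓ₄ / a β := by
    rw [le_div_iff₀ ha']; linarith
  have hR₂a : 2 ≤ R₂ := Nat.le_floor (by exact_mod_cast hq2)
  have hR₂b : (R₂ : ℝ) ≤ ℓ₄ / a β := Nat.floor_le (by positivity)
  have hR₂c : ℓ₄ / a β < (R₂ : ℝ) + 1 := Nat.lt_floor_add_one _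
  set R : ℕ := min R₁ R₂ with hR_def
  have hR1 : 1 ≤ R := le_min hR₁a (le_trans (by norm_num) hR₂a)
  have hRR₁ : R ≤ R₁ := min_le_left _ _
  have hRR₂ : R ≤ R₂ := min_le_right _ _
  have hRa : (R : ℝ) * a β ≤ ℓ₄ := by
    have h1 : (R : ℝ) ≤ R₂ := by exact_mod_cast hRR₂
    have h2 : (R : ℝ) ≤ ℓ₄ / a β := h1.trans hR₂b
    rwa [le_div_iff₀ ha'] at h2
  have hRL : 4 * R + 8 ≤ L := by omega
  have hsepk : (2 * (R : ℤ) + 4) ≤ |((((x k - y k : ℤ) : ZMod (2 * L + 1))).valMinAbs : ℤ)| := by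
    rw [Int.abs_eq_natAbs]
    have : 2 * R + 4 ≤ m := by omega
    exact_mod_cast this
  -- the collar output at `n = 2`
  have hcov := abs_torusCov_le_of_momentBounds_two r β
    (fun n z hz => H β (le_trans (le_max_left _ _) hβ) L n z R hR1 hRa hRL hz) x y ⟨k, hsepk⟩
  -- `d / R ≤ max 16 (2ℓ/ℓ₄)`
  have hR0 : (0 : ℝ) < R := by exact_mod_cast hR1
  have hd0 : 0 ≤ d := by rw [hd_def]; unfold torusDist; exact Real.sqrt_nonneg _
  have hratio : (d / R) ^ 8 ≤ 16 ^ 8 + (2 * ℓ / ℓ₄) ^ 8 := by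
    rcases min_choice R₁ R₂ with hc | hc
    · -- `R = R₁ ≥ m/8`, `d ≤ 2m`
      have hRm : (m : ℝ) ≤ 8 * (R : ℝ) := by
        rw [hR_def, hc]; exact_mod_cast hR₁c
      have h1 : d / R ≤ 16 := by
        rw [div_le_iff₀ hR0]; linarith
      have h2 : (d / R) ^ 8 ≤ 16 ^ 8 := pow_le_pow_left₀ (div_nonneg hd0 hR0.le) h1 8
      linarith [pow_nonneg (by positivity : (0 : ℝ) ≤ 2 * ℓ / ℓ₄) 8]
    · -- `R = R₂ ≥ ℓ₄/(2a)`, `d ≤ ℓ/a`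
      have hR₂d : ℓ₄ / (2 * a β) ≤ (R : ℝ) := by
        rw [hR_def, hc]
        rw [div_le_iff₀ (by positivity)]
        have : ℓ₄ / a β * a β = ℓ₄ := by field_simp
        nlinarith [hR₂c, hq2, this, ha']
      have h1 : d / R ≤ 2 * ℓ / ℓ₄ := by
        rw [div_le_div_iff₀ hR0 hℓ₄]
        -- `d ℓ₄ ≤ 2ℓ R`: `d ℓ₄ = (a d)(ℓ₄/a) ≤ ℓ · 2R`
        have h3 : d * ℓ₄ ≤ ℓ * (ℓ₄ / a β) := by
          rw [show ℓ * (ℓ₄ / a β) = (ℓ / a β) * ℓ₄ by ring]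
          refine mul_le_mul_of_nonneg_right ?_ hℓ₄.le
          rw [le_div_iff₀ ha']; linarith
        have h4 : ℓ * (ℓ₄ / a β) ≤ 2 * ℓ * R := by
          have : ℓ₄ / a β = 2 * (ℓ₄ / (2 * a β)) := by field_simp
          rw [this]; nlinarith [hR₂d, hℓ]
        linarith
      have h2 : (d / R) ^ 8 ≤ (2 * ℓ / ℓ₄) ^ 8 := pow_le_pow_left₀ (div_nonneg hd0 hR0.le) h1 8
      linarith [pow_nonneg (by norm_num : (0 : ℝ) ≤ 16) 8]
  -- conclude
  calc d ^ 8 * |torusCov G r β L x y| ≤ d ^ 8 * (C / (R : ℝ) ^ 4) ^ 2 :=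
        mul_le_mul_of_nonneg_left hcov (by positivity)
    _ = C ^ 2 * (d / R) ^ 8 := by
        field_simp
    _ ≤ C ^ 2 * (16 ^ 8 + (2 * ℓ / ℓ₄) ^ 8) := mul_le_mul_of_nonneg_left hratio (sq_nonneg C)

/-- **The LOCAL scale-free kernel clause from the spine's UV leg `MomentBounds6`.** [folklore] -/
theorem localScaleFree_of_momentBounds6 {a : ℝ → ℝ} (ha : ∀ β, 0 < a β) (ha0 : Tendsto a atTop (𝓝 0))
    (h : MomentBounds6 G r a) (ℓ : ℝ) (hℓ : 0 < ℓ) :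
    ∃ C₁ : ℝ, ∃ n₀ : ℕ, ∃ β₀ : ℝ, ∀ β : ℝ, β₀ ≤ β → ∀ (L : ℕ) (x y : Fin 4 → ℤ),
      (n₀ : ℝ) ≤ torusDist L x y → a β * torusDist L x y ≤ ℓ →
        torusDist L x y ^ 8 * |torusCov G r β L x y| ≤ C₁ :=
  localScaleFree_of_momentBounds r ha ha0 (momentBounds_of_momentBounds6 r a h) ℓ hℓ

end Cov

end Summit.QuantumFields.YangMills.Cruxes.RunningCouplingCeiling.Pointwise

end
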